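import Summits.KontsevichZagierPeriods.KontsevichZagierPeriods.Theorems.LinRedNormalFormArrangementNormalFormSeparateThreeHHKSector
import Summits.KontsevichZagierPeriods.KontsevichZagierPeriods.Theorems.LinRedNormalFormArrangementNormalFormSeparateThreeHHKTaylor

/-!
# The wall block along a nested thin sector at a point of the pole plane

(Line `janus-bands`, crux `ArrangementNormalForm`, stub `stub_separateHigh`, part `HHKSectorB` of
the wall-invariant termwise-split lemma `separateThree_hHk` in base dimension `3` with fibres.)
The common denominator of the Taylor pieces over the base `ℝ³` is
`common(x) = (∏ⱼ Lⱼ(x)^{eⱼ}) · λ(x)^n` with the letters `Lⱼ(x) = κⱼ₀ x₀ + κⱼ₁ x₁ + μⱼ` (`lval3`)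
and the pole coordinate `λ` (`SepHHK.lam3`). At a base point `z₁` OF THE POLE PLANE, along a
nested thin sector `x = z₁ + t (d + v (Q + u S))`, every wall through `z₁` (the pole plane and
the letters `j ∈ thr` vanishing at `z₁` with `eⱼ ≠ 0`) has a nested affine value
`t (α + v (β + u γ))` (`lval3_npt`, `lam3_npt`), hence (part `HHKSector`) is a monomial
`t v^{evx} u^{eux}` times a regular factor; the other letters form a regular block `Wfar`. So
`common(x) = t^{Dt} v^{Dv} u^{Du} · ω3(t, v, u)` (`common_npt`, registered as
`separateThreeHHK_sectorB`) with an explicit continuous `ω3` whose value at the corner is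
non-zero (`continuous_omega3`, `omega3_corner_ne_zero`), whence two-sided bounds near the corner
(`omega3_bounds`): the input `ω` of the weight `SepHHK.wt3`.
-/

noncomputable section

open Set MeasureTheory Filter Topology
open scoped ENNReal

namespace Summit.KontsevichZagierPeriods.ArrangementNormalForm.JanusBands

namespace SepHHK

open SepTwo

variable {m : ℕ} (κ : Fin m → Fin 2 → ℝ) (μ : Fin m → ℝ) (e : Fin m → ℕ) (n : ℕ) (l₁ l₂ l₀ : ℝ)

/-! ### Letters and the common denominator -/

/-- The value of the letter `j` at a base point. -/
def lval3 (j : Fin m) (x : Fin 3 → ℝ) : ℝ := κ j 0 * x 0 + κ j 1 * x 1 + μ j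

/-- The linear part of the letter `j`. -/
def klin (j : Fin m) (y : Fin 3 → ℝ) : ℝ := κ j 0 * y 0 + κ j 1 * y 1

/-- The common denominator of the Taylor pieces. -/
def common (x : Fin 3 → ℝ) : ℝ := (∏ j, lval3 κ μ j x ^ e j) * lam3 l₁ l₂ l₀ x ^ n

/-- Letters along a nested sector. -/
theorem lval3_npt (j : Fin m) (z₁ d Q S : Fin 3 → ℝ) (t v u : ℝ) :
    lval3 κ μ j (npt z₁ d Q S t v u) =
      lval3 κ μ j z₁ + t * (klin κ j d + v * (klin κ j Q + u * klin κ j S)) := by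
  simp only [lval3, klin, npt]; ring

/-- The pole coordinate along a nested sector. -/
theorem lam3_npt (z₁ d Q S : Fin 3 → ℝ) (t v u : ℝ) :
    lam3 l₁ l₂ l₀ (npt z₁ d Q S t v u) =
      lam3 l₁ l₂ l₀ z₁ + t * (lamL l₁ l₂ d + v * (lamL l₁ l₂ Q + u * lamL l₁ l₂ S)) := by
  simp only [lam3, lamL, npt]; ring

/-- The letters through `z₁` (active ones only). -/
def thr (z₁ : Fin 3 → ℝ) : Finset (Fin m) :=
  Finset.univ.filter fun j => lval3 κ μ j z₁ = 0 ∧ e j ≠ 0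

/-- The regular block of the other letters. -/
def Wfar (z₁ x : Fin 3 → ℝ) : ℝ := ∏ j ∈ (thr κ μ e z₁)ᶜ, lval3 κ μ j x ^ e j

/-- The `t`-exponent of the common denominator along the sector. -/
def Dt3 (z₁ : Fin 3 → ℝ) : ℕ := n + ∑ j ∈ thr κ μ e z₁, e j

/-- The `v`-exponent of the common denominator along the sector. -/
def Dv3 (z₁ d : Fin 3 → ℝ) : ℕ :=
  n * evx (lamL l₁ l₂ d) + ∑ j ∈ thr κ μ e z₁, e j * evx (klin κ j d)

/-- The `u`-exponent of the common denominator along the sector. -/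
def Du3 (z₁ d Q : Fin 3 → ℝ) : ℕ :=
  n * eux (lamL l₁ l₂ d) (lamL l₁ l₂ Q) + ∑ j ∈ thr κ μ e z₁, e j * eux (klin κ j d) (klin κ j Q)

/-- The regular factor of the common denominator along the sector. -/
def omega3 (z₁ d Q S : Fin 3 → ℝ) (t v u : ℝ) : ℝ :=
  Wfar κ μ e z₁ (npt z₁ d Q S t v u) *
    unx (lamL l₁ l₂ d) (lamL l₁ l₂ Q) (lamL l₁ l₂ S) v u ^ n *
    ∏ j ∈ thr κ μ e z₁, unx (klin κ j d) (klin κ j Q) (klin κ j S) v u ^ e j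

/-- Powers of a nested affine value. -/
theorem nest_pow (t v u α β γ : ℝ) (k : ℕ) :
    (t * (α + v * (β + u * γ))) ^ k =
      t ^ k * (v ^ (k * evx α) * (u ^ (k * eux α β) * unx α β γ v u ^ k)) := by
  rw [nest_factor, mul_pow, mul_pow, mul_pow, ← pow_mul, ← pow_mul, mul_comm (evx α),
    mul_comm (eux α β)]
  ring

/-- **The common denominator along a nested sector at a point of the pole plane.** -/
theorem common_npt (z₁ d Q S : Fin 3 → ℝ) (hlam : lam3 l₁ l₂ l₀ z₁ = 0) (t v u : ℝ) :
    common κ μ e n l₁ l₂ l₀ (npt z₁ d Q S t v u) =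
      t ^ Dt3 κ μ e n z₁ * v ^ Dv3 κ μ e n l₁ l₂ z₁ d * u ^ Du3 κ μ e n l₁ l₂ z₁ d Q *
        omega3 κ μ e n l₁ l₂ z₁ d Q S t v u := by
  classical
  unfold common omega3 Dt3 Dv3 Du3 Wfar
  rw [← Finset.prod_mul_prod_compl (thr κ μ e z₁) (fun j => lval3 κ μ j (npt z₁ d Q S t v u) ^ e j)]
  -- the letters through `z₁`
  have hthr : ∀ j ∈ thr κ μ e z₁, lval3 κ μ j (npt z₁ d Q S t v u) ^ e j =
      t ^ e j * (v ^ (e j * evx (klin κ j d)) * (u ^ (e j * eux (klin κ j d) (klin κ j Q)) *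
        unx (klin κ j d) (klin κ j Q) (klin κ j S) v u ^ e j)) := by
    intro j hj
    have h0 : lval3 κ μ j z₁ = 0 := (Finset.mem_filter.1 hj).2.1
    rw [lval3_npt, h0, zero_add, nest_pow]
  rw [Finset.prod_congr rfl hthr, Finset.prod_mul_distrib, Finset.prod_mul_distrib,
    Finset.prod_mul_distrib, Finset.prod_pow_eq_pow_sum, Finset.prod_pow_eq_pow_sum,
    Finset.prod_pow_eq_pow_sum]
  -- the pole coordinate
  rw [lam3_npt, hlam, zero_add, nest_pow, pow_add, pow_add, pow_add]
  ring

/-! ### Regularity of the factor `ω3` -/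

/-- The regular factor of a nested affine value is continuous. -/
theorem continuous_unx (α β γ : ℝ) : Continuous fun p : ℝ × ℝ => unx α β γ p.1 p.2 := by
  unfold unx
  split_ifs <;> fun_prop

/-- The regular factor of a nested affine value at the corner is the leading value. -/
theorem unx_corner_ne_zero {α β γ : ℝ} (hne : α ≠ 0 ∨ β ≠ 0 ∨ γ ≠ 0) : unx α β γ 0 0 ≠ 0 := by
  unfold unx
  split_ifs with h1 h2
  · simpa using h1
  · simpa using h2
  · push Not at h1 h2
    rcases hne with h | h | h
    · exact absurd h1 h
    · exact absurd h2 h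
    · exact h

/-- The far block is continuous. -/
theorem continuous_Wfar (z₁ : Fin 3 → ℝ) : Continuous (Wfar κ μ e z₁) := by
  unfold Wfar lval3
  exact continuous_finsetProd _ fun j _ => by fun_prop

/-- The far block does not vanish at `z₁`. -/
theorem Wfar_ne_zero (z₁ : Fin 3 → ℝ) : Wfar κ μ e z₁ z₁ ≠ 0 := by
  classical
  unfold Wfar
  refine Finset.prod_ne_zero_iff.2 fun j hj => ?_
  rw [Finset.mem_compl, thr, Finset.mem_filter, not_and_or] at hj
  rcases hj with hj | hj
  · exact absurd (Finset.mem_univ j) hj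
  · rw [not_and_or, not_not] at hj
    rcases hj with hj | hj
    · exact pow_ne_zero _ hj
    · rw [hj, pow_zero]; exact one_ne_zero

/-- **The regular factor is continuous in `(t, v, u)`.** -/
theorem continuous_omega3 (z₁ d Q S : Fin 3 → ℝ) :
    Continuous fun p : ℝ × ℝ × ℝ => omega3 κ μ e n l₁ l₂ z₁ d Q S p.1 p.2.1 p.2.2 := by
  unfold omega3
  refine Continuous.mul (Continuous.mul ?_ ?_) ?_
  · exact (continuous_Wfar κ μ e z₁).comp (continuous_npt z₁ d Q S)
  · exact ((continuous_unx _ _ _).comp continuous_snd).pow _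
  · exact continuous_finsetProd _ fun j _ => ((continuous_unx _ _ _).comp continuous_snd).pow _

/-- **The regular factor does not vanish at the corner** (all walls genuine on the frame). -/
theorem omega3_corner_ne_zero (z₁ d Q S : Fin 3 → ℝ)
    (hL : n = 0 ∨ (lamL l₁ l₂ d ≠ 0 ∨ lamL l₁ l₂ Q ≠ 0 ∨ lamL l₁ l₂ S ≠ 0))
    (hκ : ∀ j ∈ thr κ μ e z₁, klin κ j d ≠ 0 ∨ klin κ j Q ≠ 0 ∨ klin κ j S ≠ 0) :
    omega3 κ μ e n l₁ l₂ z₁ d Q S 0 0 0 ≠ 0 := by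
  unfold omega3
  have hnpt : npt z₁ d Q S 0 0 0 = z₁ := by funext k; simp [npt]
  rw [hnpt]
  refine mul_ne_zero (mul_ne_zero (Wfar_ne_zero κ μ e z₁) ?_)
    (Finset.prod_ne_zero_iff.2 fun j hj => pow_ne_zero _ (unx_corner_ne_zero (hκ j hj)))
  rcases hL with hn | h
  · rw [hn, pow_zero]; exact one_ne_zero
  · exact pow_ne_zero _ (unx_corner_ne_zero h)

/-- **Two-sided bounds of the regular factor near the corner.** -/
theorem omega3_bounds (z₁ d Q S : Fin 3 → ℝ)
    (hL : n = 0 ∨ (lamL l₁ l₂ d ≠ 0 ∨ lamL l₁ l₂ Q ≠ 0 ∨ lamL l₁ l₂ S ≠ 0))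
    (hκ : ∀ j ∈ thr κ μ e z₁, klin κ j d ≠ 0 ∨ klin κ j Q ≠ 0 ∨ klin κ j S ≠ 0) :
    ∃ ωlo > 0, ∃ ωhi : ℝ, ∃ ρ > 0, ∀ t v u : ℝ, |t| < ρ → |v| < ρ → |u| < ρ →
      ωlo ≤ |omega3 κ μ e n l₁ l₂ z₁ d Q S t v u| ∧ |omega3 κ μ e n l₁ l₂ z₁ d Q S t v u| ≤ ωhi := by
  set f : ℝ × ℝ × ℝ → ℝ := fun p => omega3 κ μ e n l₁ l₂ z₁ d Q S p.1 p.2.1 p.2.2 with hf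
  have hfc : Continuous f := continuous_omega3 κ μ e n l₁ l₂ z₁ d Q S
  have hf0 : f 0 ≠ 0 := omega3_corner_ne_zero κ μ e n l₁ l₂ z₁ d Q S hL hκ
  have hpos : 0 < |f 0| / 2 := half_pos (abs_pos.2 hf0)
  obtain ⟨ρ, hρ, hb⟩ := Metric.continuousAt_iff.1 hfc.continuousAt (|f 0| / 2) hpos
  refine ⟨|f 0| / 2, hpos, |f 0| + |f 0| / 2, ρ, hρ, fun t v u ht hv hu => ?_⟩
  have hd : dist ((t, v, u) : ℝ × ℝ × ℝ) 0 < ρ := by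
    rw [Prod.dist_eq, Prod.dist_eq]
    simp only [Prod.fst_zero, Prod.snd_zero, Real.dist_eq, sub_zero]
    exact max_lt ht (max_lt hv hu)
  have h := hb hd
  rw [Real.dist_eq] at h
  have h1 := abs_sub_abs_le_abs_sub (f (t, v, u)) (f 0)
  have h2 := abs_sub_abs_le_abs_sub (f 0) (f (t, v, u))
  rw [abs_sub_comm] at h2
  exact ⟨by simp only [hf] at h1 h2 h ⊢; linarith, by simp only [hf] at h1 h2 h ⊢; linarith⟩

/-- The absolute value of the common denominator along the sector. -/
theorem abs_common_npt (z₁ d Q S : Fin 3 → ℝ) (hlam : lam3 l₁ l₂ l₀ z₁ = 0) {t v u : ℝ}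
    (ht : 0 ≤ t) (hv : 0 ≤ v) (hu : 0 ≤ u) :
    |common κ μ e n l₁ l₂ l₀ (npt z₁ d Q S t v u)| =
      t ^ Dt3 κ μ e n z₁ * v ^ Dv3 κ μ e n l₁ l₂ z₁ d * u ^ Du3 κ μ e n l₁ l₂ z₁ d Q *
        |omega3 κ μ e n l₁ l₂ z₁ d Q S t v u| := by
  rw [common_npt κ μ e n l₁ l₂ l₀ z₁ d Q S hlam, abs_mul, abs_mul, abs_mul, abs_pow, abs_pow, abs_pow,
    abs_of_nonneg ht, abs_of_nonneg hv, abs_of_nonneg hu]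

/-- The `v`-exponent vanishes when no wall contains the direction. -/
theorem Dv3_eq_zero (z₁ d : Fin 3 → ℝ) (hL : n = 0 ∨ lamL l₁ l₂ d ≠ 0)
    (hκ : ∀ j ∈ thr κ μ e z₁, klin κ j d ≠ 0) : Dv3 κ μ e n l₁ l₂ z₁ d = 0 := by
  unfold Dv3
  have h1 : n * evx (lamL l₁ l₂ d) = 0 := by
    rcases hL with h | h
    · rw [h, zero_mul]
    · rw [(evx_eux_of_ne h 0).1, mul_zero]
  rw [h1, zero_add]
  exact Finset.sum_eq_zero fun j hj => by rw [(evx_eux_of_ne (hκ j hj) 0).1, mul_zero]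

/-- The `u`-exponent vanishes when no wall contains both the direction and the first frame
vector. -/
theorem Du3_eq_zero (z₁ d Q : Fin 3 → ℝ) (hL : n = 0 ∨ (lamL l₁ l₂ d ≠ 0 ∨ lamL l₁ l₂ Q ≠ 0))
    (hκ : ∀ j ∈ thr κ μ e z₁, klin κ j d ≠ 0 ∨ klin κ j Q ≠ 0) :
    Du3 κ μ e n l₁ l₂ z₁ d Q = 0 := by
  unfold Du3
  have h1 : n * eux (lamL l₁ l₂ d) (lamL l₁ l₂ Q) = 0 := by
    rcases hL with h | h
    · rw [h, zero_mul]
    · rw [eux_of_ne h, mul_zero]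
  rw [h1, zero_add]
  exact Finset.sum_eq_zero fun j hj => by rw [eux_of_ne (hκ j hj), mul_zero]

end SepHHK

/-- **The common denominator of the Taylor pieces along a nested thin sector at a point of the
pole plane** (registered part of `stub_separateHigh`, base dimension `3` with fibres; literal form
of `SepHHK.common_npt`): it factors as `t^{Dt} v^{Dv} u^{Du}` times the explicit regular factor
`SepHHK.omega3`. -/
theorem separateThreeHHK_sectorB (m : ℕ) (κ : Fin m → Fin 2 → ℝ) (μ : Fin m → ℝ) (e : Fin m → ℕ) (n : ℕ) (l₁ l₂ l₀ : ℝ) (z₁ d Q S : Fin 3 → ℝ) (hlam : z₁ 2 - (l₁ * z₁ 0 + l₂ * z₁ 1 + l₀) = 0) (t v u : ℝ) : (∏ j, (κ j 0 * (z₁ 0 + t * (d 0 + v * (Q 0 + u * S 0))) + κ j 1 * (z₁ 1 + t * (d 1 + v * (Q 1 + u * S 1))) + μ j) ^ e j) * ((z₁ 2 + t * (d 2 + v * (Q 2 + u * S 2))) - (l₁ * (z₁ 0 + t * (d 0 + v * (Q 0 + u * S 0))) + l₂ * (z₁ 1 + t * (d 1 + v * (Q 1 + u * S 1))) + l₀))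 ^ n = t ^ SepHHK.Dt3 κ μ e n z₁ * v ^ SepHHK.Dv3 κ μ e n l₁ l₂ z₁ d * u ^ SepHHK.Du3 κ μ e n l₁ l₂ z₁ d Q * SepHHK.omega3 κ μ e n l₁ l₂ z₁ d Q S t v u := by
  exact SepHHK.common_npt κ μ e n l₁ l₂ l₀ z₁ d Q S hlam t v u

end Summit.KontsevichZagierPeriods.ArrangementNormalForm.JanusBands
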